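import Summits.MatrixMultiplication.MatrixMultiplication.Theorems.SoloInformedConverseDoorLimit
import Literature.Computability.AlgebraicComplexity.AsymptoticRankMultiplesMatMul
import Literature.Computability.AlgebraicComplexity.AlmanLi2026SpectrumMatMul
import Literature.Computability.AlgebraicComplexity.BigCoppersmithWinogradProofs
import Literature.Computability.AlgebraicComplexity.FlatteningRank
import Literature.Barriers.MatrixMultiplication.UniversalMethodBarrierAsymptoticRank
import Literature.Barriers.MatrixMultiplication.UniversalMethodBarrierCwCore
import Literature.Barriers.MatrixMultiplication.IrreversibilityBarrierThm19
import HarnessLib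

/-!
# Route `SaturationLadder` — the SPECTRAL FLOOR of a certificate; «exactness forces flatness»
(decomp-mm lens 1 «grading / quantitative ladder», gen 25; route-free helper: imports NO `Theses` file)

Every tensor-method upper bound on a rectangular exponent is a CERTIFICATE: a degeneration
`T^{⊗N} ⊵ ⟨t⟩ ⊗ ⟨q^a,q^b,q^c⟩` of a power of a fixed base tensor `T`, read through Schönhage's inequality
`t·q^{ω(a,b,c)} ≤ R̃(T)^N ≤ r^N` (`R̃(T) ≤ r`); it certifies `ω(a,b,c) ≤ U := (N log r − log t)/log q`
(`certificate_mul_rpow_le`, `certificate_omegaRect_le`).  Gen 24 ran ONE such family (little CW `cw_q`, all shapes) and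
found its thin points EXACTLY tight (`ω(A,B,C) = A+C`, the flattening bound) precisely under `R̃(cw_q) = q+1`.  Here,
for EVERY base tensor and with no named fact as hypothesis:
* `spectral_packing_le` — for every universal spectral point `F ∈ Δ` (monotone under degeneration by the tree's
  `IsUniversalSpectralPoint.mono_of_algDegeneratesTo`): `t · F(⟨A,B,C⟩) ≤ F(T)^N`; at the three gauge points
  (flattening ranks): `t·AC ≤ ζ⁽¹⁾(T)^N`, `t·AB ≤ ζ⁽²⁾(T)^N`, `t·CB ≤ ζ⁽³⁾(T)^N` (`gaugeᵢ_packing_le`).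
* the FLOOR (the structure of CLLZ 2025 Thm. 3.10, here for arbitrary shapes and degenerations; real-arithmetic core
  `floor_of_packing`: `t·q^s ≤ Z^N`, `1 < Z ≤ r ⟹ s·log r/log Z ≤ U`) at the gauge points (`gauge₁_floor`, `gauge₂_floor`,
  `gauge₃_floor`): **`(a+c)·log r/log ζ⁽¹⁾(T) ≤ U`**, `(a+b)·log r/log ζ⁽²⁾(T) ≤ U`, `(b+c)·log r/log ζ⁽³⁾(T) ≤ U`; with the best admissible
  `r = R̃(T)` (`gauge₁_floor_asymptoticRank`) the certified exponent exceeds the flattening lower bound `a+c ≤ ω(a,b,c)`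
  by the RELATIVE factor `1 + κ₁(T)`, `κ₁(T) := log R̃(T)/log ζ⁽¹⁾(T) − 1 ≥ 0`, at EVERY level, for EVERY shape.
* `asymptoticRank_eq_flatteningRank_of_exact` — **exactness forces flatness**: if powers of ONE tensor `T` certify
  `x`-tight points to within every factor `1+ε`, then `R̃(T) = ζ⁽¹⁾(T)`.  The lens's `η`-axis («how non-flat may the
  base tensor be») has NO intermediate rungs: exact thin points — the currency of the crux `SubexpSaturation`
  (stmt-MatrixMultiplication-25909, `ω(1,t,r) ≤ 1+r`) — come from flat base tensors or from none.
* `littleCw_floor`, `littleCw_flat_of_exact` (`ζ⁽ⁱ⁾(cw_q) = q+1` on all legs: `cwTensor_swap₁₂/₁₃`, `gaugePoint₂/₃_cwTensor`):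
  every certificate from any power of `cw_q` obeys `max(a+c,a+b,b+c)·log r/log(q+1) ≤ U`, and an exact family forces
  `R̃(cw_q) = q+1` — gen 24's hypothesis `Flat(cw_q)` is NECESSARY for its segment, at all levels (its
  `littleCwCert_eq_iff` was the first power).  `bigCw_flat`, `bigCw_gauge_floor_trivial`: `CW_q` is flat
  (`R̃ = ζ⁽¹⁾ = q+2`, tree), the gauge floor is silent there — its obstruction is the `θ`-axis of gens 15–16.

Placement: the inequality is the vertex case `θ ∈ {e₁,e₂,e₃}` of the catalogued `RectangularBarrier` (CLLZ Thm. 3.10 /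
eq. (5), formalised in the tree for RESTRICTION `T`-methods onto `⟨n,n,m⟩` and adequate maps whose instances `ζ^θ` rest
on named facts) and the flattening member of the `UniversalMethodBarrier`/`IrreversibilityBarrier` family (slice rank and
subrank are finer).  New: hypothesis-free (gauge points ∈ Δ and `ζ⁽¹⁾ ≤ R̃` are PROVED in the tree), general and thin
shapes, degenerations, and the exactness reading, for which the vertex functional is the decisive one.  Support module
beneath stmt-MatrixMultiplication-25909; closes no item; imports only BUILT modules.
[cite: ChristandlLeGallLysikovZuiddam2020, Thm. 3.10 and eq. (5); ChristandlVranaZuiddam2023, Example 1.4 and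
Prop. 1.6; AlmanDuanVassilevskaWilliamsXuXuZhou2025, Thm. 3.2; Strassen1988, §3] -/

set_option linter.dupNamespace false

noncomputable section

open scoped BigOperators

namespace Summit.MatrixMultiplication.MatrixMultiplication.Theorems.SaturationLadderSpectralFloor

open Literature.Computability.AlgebraicComplexity
open Literature.Barriers.MatrixMultiplication
open Summit.MatrixMultiplication.MatrixMultiplication.Theorems.ConverseDoorLimit
  (spectral_le_of_polyDegeneratesTo map_unitTensor)  -- landed, imported

variable {K : Type} [Field K]
variable {ι κ μ : Type} [Fintype ι] [Fintype κ] [Fintype μ]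

/-! ## 1. Spectral packing: `T^{⊗N} ⊵ ⟨t⟩ ⊗ ⟨A,B,C⟩ ⟹ t · F(⟨A,B,C⟩) ≤ F(T)^N` -/

section Packing

/-- **Spectral packing inequality.** If the `N`-th power of `T` degenerates to `t` independent copies of
`⟨A,B,C⟩`, then `t · F(⟨A,B,C⟩) ≤ F(T)^N` for every universal spectral point `F` (monotone under
degeneration, multiplicative, `F(⟨t⟩) = t`). [cite: ChristandlVranaZuiddam2023, §1.2; Strassen1988, §3] -/
theorem spectral_packing_le {F : SpectralMap K} (hF : IsUniversalSpectralPoint K F)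
    (T : ι → κ → μ → K) (N t A B C : ℕ)
    (h : PolyDegeneratesTo (kroneckerPow T N)
      (kroneckerTensor (unitTensor K t) (matMulTensor K A B C))) :
    (t : ℝ) * F (matMulTensor K A B C) ≤ F T ^ N := by
  have h1 := spectral_le_of_polyDegeneratesTo hF h
  rw [hF.map_kronecker, map_unitTensor hF, hF.map_kroneckerPow] at h1
  exact h1

/-- Gauge point 1 (flattening along the output leg): `t · AC ≤ ζ⁽¹⁾(T)^N` (`B ≥ 1`).
[cite: ChristandlVranaZuiddam2023, Example 1.4] -/
theorem gauge₁_packing_le (T : ι → κ → μ → K) (N t A B C : ℕ) (hB : 0 < B)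
    (h : PolyDegeneratesTo (kroneckerPow T N)
      (kroneckerTensor (unitTensor K t) (matMulTensor K A B C))) :
    (t : ℝ) * ((A * C : ℕ) : ℝ) ≤ (flatteningRank T : ℝ) ^ N := by
  have h1 := spectral_packing_le (gaugePoint₁_isUniversalSpectralPoint K) T N t A B C h
  rwa [gaugePoint₁_matMulTensor hB, gaugePoint₁_eq] at h1

/-- Gauge point 2 (flattening along the first input leg): `t · AB ≤ ζ⁽²⁾(T)^N` (`C ≥ 1`).
[cite: ChristandlVranaZuiddam2023, Example 1.4] -/
theorem gauge₂_packing_le (T : ι → κ → μ → K) (N t A B C : ℕ) (hC : 0 < C)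
    (h : PolyDegeneratesTo (kroneckerPow T N)
      (kroneckerTensor (unitTensor K t) (matMulTensor K A B C))) :
    (t : ℝ) * ((A * B : ℕ) : ℝ) ≤ gaugePoint₂ K T ^ N := by
  have h1 := spectral_packing_le (gaugePoint₂_isUniversalSpectralPoint K) T N t A B C h
  rwa [gaugePoint₂_matMulTensor hC] at h1

/-- Gauge point 3 (flattening along the second input leg): `t · CB ≤ ζ⁽³⁾(T)^N` (`A ≥ 1`).
[cite: ChristandlVranaZuiddam2023, Example 1.4] -/
theorem gauge₃_packing_le (T : ι → κ → μ → K) (N t A B C : ℕ) (hA : 0 < A)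
    (h : PolyDegeneratesTo (kroneckerPow T N)
      (kroneckerTensor (unitTensor K t) (matMulTensor K A B C))) :
    (t : ℝ) * ((C * B : ℕ) : ℝ) ≤ gaugePoint₃ K T ^ N := by
  have h1 := spectral_packing_le (gaugePoint₃_isUniversalSpectralPoint K) T N t A B C h
  rwa [gaugePoint₃_matMulTensor hA] at h1

end Packing

/-! ## 2. What a certificate certifies -/

section Certificate

/-- **The certificate** (Schönhage's asymptotic sum inequality in the form ADVXXZ 2025 Thm. 3.2, and
`R̃` monotone under degeneration and sub-multiplicative on powers): `T^{⊗N} ⊵ ⟨t⟩ ⊗ ⟨q^a,q^b,q^c⟩`,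
`N ≥ 1`, `t ≥ 1`, `q ≥ 2`, `R̃(T) ≤ r` ⟹ `t · q^{ω(a,b,c)} ≤ r^N`.
[cite: AlmanDuanVassilevskaWilliamsXuXuZhou2025, Thm. 3.2] -/
theorem certificate_mul_rpow_le [DecidableEq ι] [DecidableEq κ] [DecidableEq μ]
    (T : ι → κ → μ → K) {N : ℕ} (hN : 0 < N) {q : ℕ} (hq : 2 ≤ q)
    (a b c : ℕ) {t : ℕ} (ht : 1 ≤ t)
    (h : PolyDegeneratesTo (kroneckerPow T N)
      (kroneckerTensor (unitTensor K t) (matMulTensor K (q ^ a) (q ^ b) (q ^ c))))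
    {r : ℝ} (hr : asymptoticRank T ≤ r) :
    (t : ℝ) * (q : ℝ) ^ omegaRect K a b c ≤ r ^ N :=
  (advxxz2025_thm32 K hq a b c ht).trans ((asymptoticRank_le_of_polyDegeneratesTo h).trans
    ((asymptoticRank_kroneckerPow_le T hN).trans (pow_le_pow_left₀ (asymptoticRank_nonneg _) hr N)))

/-- **The certified exponent bound** `U = (N log r − log t)/log q`: under the hypotheses of
`certificate_mul_rpow_le`, `ω(a,b,c) ≤ U`. [cite: AlmanDuanVassilevskaWilliamsXuXuZhou2025, Thm. 3.2] -/
theorem certificate_omegaRect_le [DecidableEq ι] [DecidableEq κ] [DecidableEq μ]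
    (T : ι → κ → μ → K) {N : ℕ} (hN : 0 < N) {q : ℕ} (hq : 2 ≤ q)
    (a b c : ℕ) {t : ℕ} (ht : 1 ≤ t)
    (h : PolyDegeneratesTo (kroneckerPow T N)
      (kroneckerTensor (unitTensor K t) (matMulTensor K (q ^ a) (q ^ b) (q ^ c))))
    {r : ℝ} (hr : asymptoticRank T ≤ r) :
    omegaRect K a b c ≤ ((N : ℝ) * Real.log r - Real.log t) / Real.log q := by
  have hle := certificate_mul_rpow_le T hN hq a b c ht h hr
  have ht0 : (0 : ℝ) < t := by exact_mod_cast (by omega : 0 < t)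
  have hq1 : (1 : ℝ) < q := by exact_mod_cast (by omega : 1 < q)
  have hq0 : (0 : ℝ) < q := by linarith
  have hlogq : 0 < Real.log q := Real.log_pos hq1
  have hlhs : 0 < (t : ℝ) * (q : ℝ) ^ omegaRect K a b c := mul_pos ht0 (Real.rpow_pos_of_pos hq0 _)
  have hrN : 0 < r ^ N := hlhs.trans_le hle
  have hr0 : 0 < r := by
    rcases lt_trichotomy r 0 with hneg | hzero | hpos
    · -- `r < 0` is impossible: `0 ≤ R̃(T) ≤ r`
      exact absurd (lt_of_le_of_lt ((asymptoticRank_nonneg T).trans hr) hneg) (lt_irrefl _)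
    · rw [hzero, zero_pow (by omega : N ≠ 0)] at hrN
      exact absurd hrN (lt_irrefl _)
    · exact hpos
  have hlog := Real.log_le_log hlhs hle
  rw [Real.log_mul ht0.ne' (Real.rpow_pos_of_pos hq0 _).ne', Real.log_rpow hq0, Real.log_pow] at hlog
  rw [le_div_iff₀ hlogq]
  linarith

end Certificate

/-! ## 3. The floor -/

section Floor

/-- **Real-arithmetic core of the floor**: `t ≥ 1`, `q ≥ 2`, `1 < Z ≤ r`, `t·q^s ≤ Z^N` ⟹
`s · log r / log Z ≤ (N log r − log t)/log q`. [cite: ChristandlLeGallLysikovZuiddam2020, Thm. 3.10] -/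
theorem floor_of_packing {t q N s : ℕ} {Z r : ℝ} (hq : 2 ≤ q) (ht : 1 ≤ t) (hZ : 1 < Z) (hr : Z ≤ r)
    (hpack : (t : ℝ) * (q : ℝ) ^ s ≤ Z ^ N) :
    (s : ℝ) * (Real.log r / Real.log Z) ≤ ((N : ℝ) * Real.log r - Real.log t) / Real.log q := by
  have hq1 : (1 : ℝ) < q := by exact_mod_cast (by omega : 1 < q)
  have hlogq : 0 < Real.log q := Real.log_pos hq1
  have ht1 : (1 : ℝ) ≤ t := by exact_mod_cast ht
  have ht0 : (0 : ℝ) < t := by linarith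
  have hlogt : 0 ≤ Real.log t := Real.log_nonneg ht1
  have hZ0 : 0 < Z := by linarith
  have hL : 0 < Real.log Z := Real.log_pos hZ
  have hlog := Real.log_le_log (mul_pos ht0 (pow_pos (by linarith) s)) hpack
  rw [Real.log_mul ht0.ne' (pow_pos (by linarith) s).ne', Real.log_pow, Real.log_pow] at hlog
  set ρ : ℝ := Real.log r / Real.log Z with hρ
  have hρ1 : 1 ≤ ρ := by rw [hρ, le_div_iff₀ hL, one_mul]; exact Real.log_le_log hZ0 hr
  have hρL : ρ * Real.log Z = Real.log r := by rw [hρ]; field_simp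
  have key : ρ * (Real.log t + (s : ℝ) * Real.log q) ≤ ρ * ((N : ℝ) * Real.log Z) :=
    mul_le_mul_of_nonneg_left hlog (by linarith)
  have hrhs : ρ * ((N : ℝ) * Real.log Z) = (N : ℝ) * Real.log r := by rw [← hρL]; ring
  have hcat : Real.log t ≤ ρ * Real.log t := le_mul_of_one_le_left hlogt hρ1
  rw [le_div_iff₀ hlogq]
  nlinarith [key, hrhs, hcat]

/-- **Floor at the first gauge point, shape `⟨q^a,q^b,q^c⟩`**: `1 < ζ⁽¹⁾(T) ≤ r`, `t ≥ 1`, `q ≥ 2`,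
`T^{⊗N} ⊵ ⟨t⟩ ⊗ ⟨q^a,q^b,q^c⟩` ⟹ **`(a + c) · log r / log ζ⁽¹⁾(T) ≤ U = (N log r − log t)/log q`**: the
certified exponent exceeds the flattening lower bound `a + c` by the relative factor `log r / log ζ⁽¹⁾(T) ≥ 1`,
at every level `N`. [cite: ChristandlLeGallLysikovZuiddam2020, Thm. 3.10 and eq. (5)] -/
theorem gauge₁_floor (T : ι → κ → μ → K) {N t q a b c : ℕ} (hq : 2 ≤ q) (ht : 1 ≤ t)
    (h : PolyDegeneratesTo (kroneckerPow T N)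
      (kroneckerTensor (unitTensor K t) (matMulTensor K (q ^ a) (q ^ b) (q ^ c))))
    (hT : 1 < flatteningRank T) {r : ℝ} (hr : (flatteningRank T : ℝ) ≤ r) :
    ((a + c : ℕ) : ℝ) * (Real.log r / Real.log (flatteningRank T : ℝ)) ≤
      ((N : ℝ) * Real.log r - Real.log t) / Real.log q := by
  have hpack := gauge₁_packing_le T N t (q ^ a) (q ^ b) (q ^ c) (pow_pos (by omega) b) h
  have he : (((q ^ a * q ^ c : ℕ)) : ℝ) = (q : ℝ) ^ (a + c) := by push_cast; ring
  rw [he] at hpack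
  exact floor_of_packing hq ht (by exact_mod_cast hT) hr hpack

/-- **Floor at the second gauge point**: `(a + b) · log r / log ζ⁽²⁾(T) ≤ U` (`1 < ζ⁽²⁾(T) ≤ r`).
[cite: ChristandlLeGallLysikovZuiddam2020, Thm. 3.10 and eq. (5)] -/
theorem gauge₂_floor (T : ι → κ → μ → K) {N t q a b c : ℕ} (hq : 2 ≤ q) (ht : 1 ≤ t)
    (h : PolyDegeneratesTo (kroneckerPow T N)
      (kroneckerTensor (unitTensor K t) (matMulTensor K (q ^ a) (q ^ b) (q ^ c))))
    (hT : 1 < gaugePoint₂ K T) {r : ℝ} (hr : gaugePoint₂ K T ≤ r) :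
    ((a + b : ℕ) : ℝ) * (Real.log r / Real.log (gaugePoint₂ K T)) ≤
      ((N : ℝ) * Real.log r - Real.log t) / Real.log q := by
  have hpack := gauge₂_packing_le T N t (q ^ a) (q ^ b) (q ^ c) (pow_pos (by omega) c) h
  have he : (((q ^ a * q ^ b : ℕ)) : ℝ) = (q : ℝ) ^ (a + b) := by push_cast; ring
  rw [he] at hpack
  exact floor_of_packing hq ht hT hr hpack

/-- **Floor at the third gauge point**: `(b + c) · log r / log ζ⁽³⁾(T) ≤ U` (`1 < ζ⁽³⁾(T) ≤ r`).
[cite: ChristandlLeGallLysikovZuiddam2020, Thm. 3.10 and eq. (5)] -/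
theorem gauge₃_floor (T : ι → κ → μ → K) {N t q a b c : ℕ} (hq : 2 ≤ q) (ht : 1 ≤ t)
    (h : PolyDegeneratesTo (kroneckerPow T N)
      (kroneckerTensor (unitTensor K t) (matMulTensor K (q ^ a) (q ^ b) (q ^ c))))
    (hT : 1 < gaugePoint₃ K T) {r : ℝ} (hr : gaugePoint₃ K T ≤ r) :
    ((b + c : ℕ) : ℝ) * (Real.log r / Real.log (gaugePoint₃ K T)) ≤
      ((N : ℝ) * Real.log r - Real.log t) / Real.log q := by
  have hpack := gauge₃_packing_le T N t (q ^ a) (q ^ b) (q ^ c) (pow_pos (by omega) a) h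
  have he : (((q ^ c * q ^ b : ℕ)) : ℝ) = (q : ℝ) ^ (b + c) := by push_cast; ring
  rw [he] at hpack
  exact floor_of_packing hq ht hT hr hpack

/-- **Floor with the best admissible `r = R̃(T)`**: every certificate from a power of `T` obeys
`(a + c) · log R̃(T) / log ζ⁽¹⁾(T) ≤ U`, i.e. the certified exponent carries the relative excess
`κ₁(T) = log R̃(T)/log ζ⁽¹⁾(T) − 1 ≥ 0` over the flattening bound, uniformly in the level. (`ζ⁽¹⁾ ≤ R̃` is
the tree's `flatteningRank_le_asymptoticRank`.) [cite: ChristandlLeGallLysikovZuiddam2020, Thm. 3.10; ChristandlVranaZuiddam2023, Example 1.4] -/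
theorem gauge₁_floor_asymptoticRank (T : ι → κ → μ → K) {N t q a b c : ℕ} (hq : 2 ≤ q) (ht : 1 ≤ t)
    (h : PolyDegeneratesTo (kroneckerPow T N)
      (kroneckerTensor (unitTensor K t) (matMulTensor K (q ^ a) (q ^ b) (q ^ c))))
    (hT : 1 < flatteningRank T) :
    ((a + c : ℕ) : ℝ) * (Real.log (asymptoticRank T) / Real.log (flatteningRank T : ℝ)) ≤
      ((N : ℝ) * Real.log (asymptoticRank T) - Real.log t) / Real.log q :=
  gauge₁_floor T hq ht h hT (flatteningRank_le_asymptoticRank T)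

end Floor

/-! ## 4. Exactness forces flatness -/

section Exact

/-- **Exact certificates live on flat tensors.** Let `ζ⁽¹⁾(T) > 1`. If for every `ε > 0` some power of `T`
degenerates to some `⟨t⟩ ⊗ ⟨q^a,q^b,q^c⟩` (`t ≥ 1`, `q ≥ 2`, `a + c ≥ 1`) whose certified exponent with
`r = R̃(T)` is within the factor `1 + ε` of the flattening lower bound, `U ≤ (1 + ε)(a + c)`, then
`R̃(T) = ζ⁽¹⁾(T)`.  Contrapositive: a base tensor with `R̃(T) > ζ⁽¹⁾(T)` certifies NO exactly `x`-tight point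
`ω(a,b,c) = a + c`, at any level, by any design. [cite: ChristandlLeGallLysikovZuiddam2020, Thm. 3.10; ChristandlVranaZuiddam2023, Example 1.4 and Prop. 1.6] -/
theorem asymptoticRank_eq_flatteningRank_of_exact (T : ι → κ → μ → K) (hT : 1 < flatteningRank T)
    (h : ∀ ε : ℝ, 0 < ε → ∃ N t q a b c : ℕ, 1 ≤ t ∧ 2 ≤ q ∧ 1 ≤ a + c ∧
      PolyDegeneratesTo (kroneckerPow T N)
        (kroneckerTensor (unitTensor K t) (matMulTensor K (q ^ a) (q ^ b) (q ^ c))) ∧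
      ((N : ℝ) * Real.log (asymptoticRank T) - Real.log t) / Real.log q ≤ (1 + ε) * ((a + c : ℕ) : ℝ)) :
    asymptoticRank T = flatteningRank T := by
  have hζR := flatteningRank_le_asymptoticRank T
  refine le_antisymm ?_ hζR
  have hζ1 : (1 : ℝ) < (flatteningRank T : ℝ) := by exact_mod_cast hT
  have hζ0 : (0 : ℝ) < (flatteningRank T : ℝ) := by linarith
  have hR0 : 0 < asymptoticRank T := hζ0.trans_le hζR
  have hL : 0 < Real.log (flatteningRank T : ℝ) := Real.log_pos hζ1
  -- `log R̃(T) ≤ log ζ⁽¹⁾(T) + δ` for every `δ > 0`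
  have hlog : Real.log (asymptoticRank T) ≤ Real.log (flatteningRank T : ℝ) := by
    refine le_of_forall_pos_le_add fun δ hδ => ?_
    obtain ⟨N, t, q, a, b, c, ht, hq, hac, hdeg, hU⟩ := h (δ / Real.log (flatteningRank T : ℝ))
      (div_pos hδ hL)
    have hfl := gauge₁_floor_asymptoticRank T hq ht hdeg hT
    have hac0 : (0 : ℝ) < ((a + c : ℕ) : ℝ) := by exact_mod_cast (by omega : 0 < a + c)
    -- `(a+c) · log R̃ / log ζ ≤ (1 + δ / log ζ) · (a+c)`
    have h1 : Real.log (asymptoticRank T) / Real.log (flatteningRank T : ℝ) ≤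
        1 + δ / Real.log (flatteningRank T : ℝ) := by
      have h2 := hfl.trans hU
      rw [mul_comm (1 + δ / Real.log (flatteningRank T : ℝ))] at h2
      exact le_of_mul_le_mul_left h2 hac0
    rw [div_le_iff₀ hL] at h1
    have h3 : (1 + δ / Real.log (flatteningRank T : ℝ)) * Real.log (flatteningRank T : ℝ) =
        Real.log (flatteningRank T : ℝ) + δ := by field_simp
    linarith [h3]
  exact (Real.log_le_log_iff hR0 hζ0).1 hlog

end Exact

/-! ## 5. The little Coppersmith–Winograd tensor: all three legs, all levels -/

section LittleCw

/-- `cw_q` is symmetric in its first two legs. [cite: ConnerGesmundoLandsbergVentura2022, eq. (1)] -/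
theorem cwTensor_swap₁₂ (q : ℕ) (a b c : Fin (q + 1)) : cwTensor K q b a c = cwTensor K q a b c := by
  simp only [cwTensor_apply]
  by_cases h1 : a = 0 <;> by_cases h2 : b = 0 <;> by_cases h3 : c = 0 <;> by_cases h4 : a = b <;>
    by_cases h5 : b = c <;> by_cases h6 : a = c <;> subst_vars <;> simp_all
  all_goals intro h; subst h; simp_all

/-- `cw_q` is symmetric under moving the third leg to the front. [cite: ConnerGesmundoLandsbergVentura2022, eq. (1)] -/
theorem cwTensor_swap₁₃ (q : ℕ) (a b c : Fin (q + 1)) : cwTensor K q c a b = cwTensor K q a b c := by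
  simp only [cwTensor_apply]
  by_cases h1 : a = 0 <;> by_cases h2 : b = 0 <;> by_cases h3 : c = 0 <;> by_cases h4 : a = b <;>
    by_cases h5 : b = c <;> by_cases h6 : a = c <;> subst_vars <;> simp_all
  all_goals intro h; subst h; simp_all

/-- `cw_q` with its first two legs swapped is `cw_q`. [cite: ConnerGesmundoLandsbergVentura2022, eq. (1)] -/
theorem cwTensor_swap₁₂_eq (q : ℕ) : (fun b a c => cwTensor K q a b c) = cwTensor K q := by
  funext b a c
  exact cwTensor_swap₁₂ (K := K) q b a c

/-- `cw_q` with its third leg moved to the front is `cw_q`. [cite: ConnerGesmundoLandsbergVentura2022, eq. (1)] -/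
theorem cwTensor_swap₁₃_eq (q : ℕ) : (fun c a b => cwTensor K q a b c) = cwTensor K q := by
  funext c a b
  exact (cwTensor_swap₁₃ (K := K) q a b c).symm

/-- `ζ⁽²⁾(cw_q) = ζ⁽¹⁾(cw_q)` (symmetry). [cite: ChristandlVranaZuiddam2023, Example 1.4] -/
theorem gaugePoint₂_cwTensor (q : ℕ) : gaugePoint₂ K (cwTensor K q) = (flatteningRank (cwTensor K q) : ℝ) := by
  rw [gaugePoint₂_eq_gaugePoint₁_swap, cwTensor_swap₁₂_eq, gaugePoint₁_eq]

/-- `ζ⁽³⁾(cw_q) = ζ⁽¹⁾(cw_q)` (symmetry). [cite: ChristandlVranaZuiddam2023, Example 1.4] -/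
theorem gaugePoint₃_cwTensor (q : ℕ) : gaugePoint₃ K (cwTensor K q) = (flatteningRank (cwTensor K q) : ℝ) := by
  rw [gaugePoint₃_eq_gaugePoint₁_swap, cwTensor_swap₁₃_eq, gaugePoint₁_eq]

/-- **Little-CW floor, all three legs, every level, every shape.** For `q₀ ≥ 1`, a degeneration
`cw_{q₀}^{⊗N} ⊵ ⟨t⟩ ⊗ ⟨q^a,q^b,q^c⟩` (`t ≥ 1`, `q ≥ 2`) and any `r ≥ q₀ + 1`:
`max(a+c, a+b, b+c) · log r / log(q₀+1) ≤ U = (N log r − log t)/log q`.  With `r = R̃(cw_{q₀}) =: (q₀+1)^{1+κ}`: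
every certified exponent is at least `(1 + κ) ·` (the flattening lower bound). [cite: ChristandlLeGallLysikovZuiddam2020, Thm. 3.10; CoppersmithWinograd1990, §6] -/
theorem littleCw_floor {q₀ : ℕ} (hq₀ : 1 ≤ q₀) {N t q a b c : ℕ} (hq : 2 ≤ q) (ht : 1 ≤ t)
    (h : PolyDegeneratesTo (kroneckerPow (cwTensor K q₀) N)
      (kroneckerTensor (unitTensor K t) (matMulTensor K (q ^ a) (q ^ b) (q ^ c))))
    {r : ℝ} (hr : (q₀ : ℝ) + 1 ≤ r) :
    ((max (a + c) (max (a + b) (b + c)) : ℕ) : ℝ) * (Real.log r / Real.log ((q₀ : ℝ) + 1)) ≤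
      ((N : ℝ) * Real.log r - Real.log t) / Real.log q := by
  have hζ : flatteningRank (cwTensor K q₀) = q₀ + 1 := flatteningRank_cwTensor hq₀
  have hζR : ((flatteningRank (cwTensor K q₀) : ℕ) : ℝ) = (q₀ : ℝ) + 1 := by rw [hζ]; push_cast; ring
  have hT1 : 1 < flatteningRank (cwTensor K q₀) := by omega
  have hT1R : (1 : ℝ) < (flatteningRank (cwTensor K q₀) : ℝ) := by exact_mod_cast hT1
  have hrζ : (flatteningRank (cwTensor K q₀) : ℝ) ≤ r := by rw [hζR]; exact hr
  -- leg 1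
  have h₁ := gauge₁_floor (cwTensor K q₀) hq ht h hT1 hrζ
  -- leg 2
  have hT2 : (1 : ℝ) < gaugePoint₂ K (cwTensor K q₀) := by rw [gaugePoint₂_cwTensor]; exact hT1R
  have hr2 : gaugePoint₂ K (cwTensor K q₀) ≤ r := by rw [gaugePoint₂_cwTensor]; exact hrζ
  have h₂ := gauge₂_floor (cwTensor K q₀) hq ht h hT2 hr2
  -- leg 3
  have hT3 : (1 : ℝ) < gaugePoint₃ K (cwTensor K q₀) := by rw [gaugePoint₃_cwTensor]; exact hT1R
  have hr3 : gaugePoint₃ K (cwTensor K q₀) ≤ r := by rw [gaugePoint₃_cwTensor]; exact hrζ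
  have h₃ := gauge₃_floor (cwTensor K q₀) hq ht h hT3 hr3
  rw [gaugePoint₂_cwTensor, hζR] at h₂
  rw [gaugePoint₃_cwTensor, hζR] at h₃
  rw [hζR] at h₁
  rcases le_total (a + c) (max (a + b) (b + c)) with hle | hle
  · rw [max_eq_right hle]
    rcases le_total (a + b) (b + c) with hle' | hle'
    · rw [max_eq_right hle']; exact h₃
    · rw [max_eq_left hle']; exact h₂
  · rw [max_eq_left hle]; exact h₁

/-- **Exactness from little CW forces `R̃(cw_q) = q + 1`.** If powers of `cw_q` (`q ≥ 1`) certify `x`-tight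
points to within every factor `1 + ε`, then `cw_q` has minimal asymptotic rank — gen 24's hypothesis `Flat(cw_q)`
of the thin sweet-spot segment is NECESSARY for any exact little-CW certificate, at every level (gen 24's
`littleCwCert_eq_iff` was the first power). [cite: CoppersmithWinograd1990, §6; ChristandlLeGallLysikovZuiddam2020, Thm. 3.10] -/
theorem littleCw_flat_of_exact {q₀ : ℕ} (hq₀ : 1 ≤ q₀)
    (h : ∀ ε : ℝ, 0 < ε → ∃ N t q a b c : ℕ, 1 ≤ t ∧ 2 ≤ q ∧ 1 ≤ a + c ∧
      PolyDegeneratesTo (kroneckerPow (cwTensor K q₀) N)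
        (kroneckerTensor (unitTensor K t) (matMulTensor K (q ^ a) (q ^ b) (q ^ c))) ∧
      ((N : ℝ) * Real.log (asymptoticRank (cwTensor K q₀)) - Real.log t) / Real.log q ≤
        (1 + ε) * ((a + c : ℕ) : ℝ)) :
    asymptoticRank (cwTensor K q₀) = (q₀ : ℝ) + 1 := by
  have hT1 : 1 < flatteningRank (cwTensor K q₀) := by rw [flatteningRank_cwTensor hq₀]; omega
  rw [asymptoticRank_eq_flatteningRank_of_exact (cwTensor K q₀) hT1 h, flatteningRank_cwTensor hq₀]
  push_cast; ring

end LittleCw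

/-! ## 6. The big Coppersmith–Winograd tensor is flat: the gauge floor is silent there -/

section BigCw

/-- **`CW_q` passes the flatness test**: `R̃(CW_q) = ζ⁽¹⁾(CW_q) = q + 2` (tree: `asymptoticRank_bigCwTensor`,
`flatteningRank_bigCwTensor`), so `κ₁(CW_q) = 0` and the gauge floor with `r = R̃(CW_q)` reads `a + c ≤ U` — the
flattening lower bound itself: no obstruction to exactness on the `η`-axis for the tensor of record (its obstruction
is the `θ`-axis of gens 15–16 of this lens). [cite: AlmanDuanVassilevskaWilliamsXuXuZhou2025, §3.6; ChristandlVranaZuiddam2021, Thm. 22] -/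
theorem bigCw_flat (q : ℕ) : asymptoticRank (bigCwTensor K q) = (flatteningRank (bigCwTensor K q) : ℝ) := by
  rw [asymptoticRank_bigCwTensor K q, flatteningRank_bigCwTensor]; push_cast; ring

/-- The gauge floor for `CW_q` with `r = R̃(CW_q) = q + 2` is exactly the flattening bound `a + c ≤ U`
(relative excess factor `log R̃ / log ζ⁽¹⁾ = 1`). [cite: AlmanDuanVassilevskaWilliamsXuXuZhou2025, §3.6] -/
theorem bigCw_gauge_floor_trivial (q : ℕ) {N t p a b c : ℕ} (hp : 2 ≤ p) (ht : 1 ≤ t)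
    (h : PolyDegeneratesTo (kroneckerPow (bigCwTensor K q) N)
      (kroneckerTensor (unitTensor K t) (matMulTensor K (p ^ a) (p ^ b) (p ^ c)))) :
    ((a + c : ℕ) : ℝ) ≤ ((N : ℝ) * Real.log ((q : ℝ) + 2) - Real.log t) / Real.log p := by
  have hT : 1 < flatteningRank (bigCwTensor K q) := by rw [flatteningRank_bigCwTensor]; omega
  have hζR : ((flatteningRank (bigCwTensor K q) : ℕ) : ℝ) = (q : ℝ) + 2 := by
    rw [flatteningRank_bigCwTensor]; push_cast; ring
  have hfl := gauge₁_floor (bigCwTensor K q) hp ht h hT (le_of_eq rfl)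
  have hL : Real.log ((flatteningRank (bigCwTensor K q) : ℕ) : ℝ) ≠ 0 :=
    (Real.log_pos (by exact_mod_cast hT)).ne'
  rw [div_self hL, mul_one, hζR] at hfl
  exact hfl

end BigCw
end Summit.MatrixMultiplication.MatrixMultiplication.Theorems.SaturationLadderSpectralFloor

end
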